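import Summits.RiemannHypothesis.RiemannHypothesis.Theorems.WeilFormatCEntryIncrement
import Summits.RiemannHypothesis.RiemannHypothesis.Theorems.WeilFormatCDefs
import HarnessLib

/-!
# rh-explicit (venture WeilGRH): THE CROSS INCREMENT OF TWO FLAT WINDOWS `N` LATTICE STEPS APART, AT ANY HEIGHT —
  `D_t(u_c, u_{c+Nπ/a}) = (−1)^N (sin((c+Nπ/a)t) − sin(ct))/(Nπ)` on `0 ≤ t ≤ 2a`, `0` beyond

Cell `rh-explicit`, WEIL TRACK (structure seat weil-3, gen13).  RH-free; the first ingredient of the general-centre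
(non-lattice) Beurling–Selberg window law: the sesquilinear INCREMENT `weilIncrementSesq u_c u_{c'} t =
∫ (u_c(x+t) − u_c(x))·conj(u_{c'}(x+t) − u_{c'}(x)) dx` of the flat window modulated to two heights `c`, `c' = c + Nπ/a`
(`u_c = e^{−icx}χ_0`).  Key remark: `u_{c+Nπ/a} = e^{−icx}·χ_{−N}` (`modulated_chi_zero_eq_mul_chi_neg`), so both
windows are the SAME modulation of two of Yoshida's basis functions, the common phase cancels inside the
increment, and the tree's shifted overlaps of basis functions (`WeilFormatCEntryIncrement`) give

* `weilIncrementSesq_modulated_pair_eq`: for `0 ≤ t ≤ 2a`, `N ≥ 1`: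
  `D_t(u_c, u_{c+Nπ/a}) = −e^{−ict}·S₁(t) − e^{ict}·conj S₁'(t)` with the tree's overlaps, and in closed real
  form **`weilIncrementSesq_modulated_pair`: `= (−1)^N (sin((c + Nπ/a)t) − sin(ct))/(Nπ)`**;
* `weilIncrementSesq_modulated_pair_of_le`: `= 0` for `t ≥ 2a`;
* `integral_modulated_pair_mul_conj`: `∫ u_c·conj u_{c+Nπ/a} = 0`.

Hence the prime block of the cross Gram term is `((−1)^N/(Nπ))Σ_{log k<2a}Λ(k)k^{-1/2}(sin(c' log k) − sin(c log k))`,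
bounded by `(2/(Nπ))T(a)` PHASE-BLIND at every real height `c` (the lattice case is Yoshida's (5.16)).

No definitions, no named facts; RH-free.
-/

set_option autoImplicit false

noncomputable section

open Complex Filter Set MeasureTheory
open scoped Real Topology ComplexConjugate

namespace Summit.Ventures.WeilGRH

open Literature.NumberTheory.LFunctions
open Literature.NumberTheory.LFunctions.Yoshida1992 (chi chiCore)
open Summit.RiemannHypothesis.RiemannHypothesis.Theorems.WeilFormatC

variable {a : ℝ}

/-- `e^{−i(c + Nπ/a)x}χ_0 = e^{−icx}·χ_{−N}`: the second window is the same modulation of the basis function `χ_{−N}`. -/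
theorem modulated_chi_zero_eq_mul_chi_neg (a c : ℝ) (N : ℕ) :
    (fun x ↦ cexp (I * ((-(c + N * π / a)) * x : ℝ)) * chi a 0 x) =
      fun x ↦ cexp (I * ((-c) * x : ℝ)) * chi a (-(N : ℤ)) x := by
  funext x
  by_cases hx : x ∈ Icc (-a) a
  · rw [chi_apply_of_mem 0 hx, chi_apply_of_mem (-(N : ℤ)) hx]
    simp only [Int.cast_zero, mul_zero, zero_mul, zero_div, Complex.exp_zero, mul_one]
    have hexp : cexp (I * (((-(c + N * π / a)) * x : ℝ) : ℂ)) =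
        cexp (I * (((-c) * x : ℝ) : ℂ)) * cexp (π * I * ((-(N : ℤ) : ℤ) : ℂ) * x / a) := by
      rw [← Complex.exp_add]; congr 1; push_cast; ring
    rw [hexp]; ring
  · rw [chi_apply_of_not_mem 0 hx, chi_apply_of_not_mem (-(N : ℤ)) hx, mul_zero, mul_zero]

/-- `∫ u_c · conj u_{c+Nπ/a} = 0` (`N ≥ 1`): the two windows are orthogonal (the common phase cancels, `χ_0 ⊥ χ_{−N}`). -/
theorem integral_modulated_pair_mul_conj (ha : 0 < a) (c : ℝ) {N : ℕ} (hN : 1 ≤ N) :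
    ∫ x, (cexp (I * ((-c) * x : ℝ)) * chi a 0 x) * conj (cexp (I * ((-(c + N * π / a)) * x : ℝ)) * chi a 0 x) = 0 := by
  have hv := modulated_chi_zero_eq_mul_chi_neg a c N
  have hpt : ∀ x, (cexp (I * ((-c) * x : ℝ)) * chi a 0 x) * conj (cexp (I * ((-(c + N * π / a)) * x : ℝ)) * chi a 0 x) =
      chi a 0 x * conj (chi a (-(N : ℤ)) x) := by
    intro x
    have e := congrFun hv x
    rw [e, map_mul, ← Complex.exp_conj, map_mul, Complex.conj_I, Complex.conj_ofReal]
    have h1 : cexp (I * ((-c) * x : ℝ)) * cexp (-I * ((-c) * x : ℝ)) = 1 := by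
      rw [← Complex.exp_add]; simp
    calc cexp (I * ((-c) * x : ℝ)) * chi a 0 x * (cexp (-I * ((-c) * x : ℝ)) * conj (chi a (-(N : ℤ)) x))
        = (cexp (I * ((-c) * x : ℝ)) * cexp (-I * ((-c) * x : ℝ))) * (chi a 0 x * conj (chi a (-(N : ℤ)) x)) := by ring
      _ = _ := by rw [h1, one_mul]
  simp_rw [hpt]
  rw [integral_chi_mul_conj_chi ha]
  have : (0 : ℤ) ≠ -(N : ℤ) := by omega
  simp [this]

/-- **The cross increment, overlap form** (`0 ≤ t`, `N ≥ 1`):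
`D_t(u_c, u_{c+Nπ/a}) = −e^{−ict}·∫χ_0(·+t)conj χ_{−N} − e^{ict}·conj ∫χ_{−N}(·+t)conj χ_0`. -/
theorem weilIncrementSesq_modulated_pair_eq (ha : 0 < a) (c : ℝ) {N : ℕ} (hN : 1 ≤ N) {t : ℝ} (ht : 0 ≤ t) :
    weilIncrementSesq (fun x ↦ cexp (I * ((-c) * x : ℝ)) * chi a 0 x)
        (fun x ↦ cexp (I * ((-(c + N * π / a)) * x : ℝ)) * chi a 0 x) t =
      -(cexp (I * ((-c) * t : ℝ)) * ∫ x, chi a 0 (x + t) * conj (chi a (-(N : ℤ)) x)) -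
        cexp (-(I * ((-c) * t : ℝ))) * conj (∫ x, chi a (-(N : ℤ)) (x + t) * conj (chi a 0 x)) := by
  unfold weilIncrementSesq
  rw [modulated_chi_zero_eq_mul_chi_neg a c N]
  set e : ℝ → ℂ := fun y ↦ cexp (I * ((-c) * y : ℝ)) with he
  have het : ∀ x, e (x + t) = e x * e t := by
    intro x; rw [he]; simp only; rw [← Complex.exp_add]; congr 1; push_cast; ring
  have hee : ∀ x, e x * conj (e x) = 1 := by
    intro x; rw [he]; simp only; rw [← Complex.exp_conj, map_mul, Complex.conj_I, Complex.conj_ofReal, ← Complex.exp_add]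
    simp
  have hne : (0 : ℤ) ≠ -(N : ℤ) := by omega
  -- pointwise expansion of the integrand
  have hpt : ∀ x, (e (x + t) * chi a 0 (x + t) - e x * chi a 0 x) *
      conj (e (x + t) * chi a (-(N : ℤ)) (x + t) - e x * chi a (-(N : ℤ)) x) =
      chi a 0 (x + t) * conj (chi a (-(N : ℤ)) (x + t)) + chi a 0 x * conj (chi a (-(N : ℤ)) x) -
        e t * (chi a 0 (x + t) * conj (chi a (-(N : ℤ)) x)) - conj (e t) * (chi a 0 x * conj (chi a (-(N : ℤ)) (x + t))) := by
    intro x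
    rw [het, map_sub, map_mul, map_mul, map_mul]
    have h1 := hee x
    have h2 : e t * conj (e t) = 1 := hee t
    linear_combination (e t * conj (e t) * (chi a 0 (x + t) * conj (chi a (-(N : ℤ)) (x + t))) -
        e t * (chi a 0 (x + t) * conj (chi a (-(N : ℤ)) x)) - conj (e t) * (chi a 0 x * conj (chi a (-(N : ℤ)) (x + t))) +
        chi a 0 x * conj (chi a (-(N : ℤ)) x)) * h1 + (chi a 0 (x + t) * conj (chi a (-(N : ℤ)) (x + t))) * h2
  simp_rw [show ∀ x, cexp (I * ((-c) * x : ℝ)) = e x from fun x ↦ rfl]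
  simp_rw [hpt]
  have iA : Integrable fun x ↦ chi a 0 (x + t) * conj (chi a (-(N : ℤ)) (x + t)) :=
    (integrable_chi_mul_conj_chi 0 (-(N : ℤ))).comp_add_right t
  have iD := integrable_chi_mul_conj_chi (a := a) 0 (-(N : ℤ))
  have iB : Integrable fun x ↦ e t * (chi a 0 (x + t) * conj (chi a (-(N : ℤ)) x)) :=
    (integrable_chi_shift_mul_conj_chi (a := a) 0 (-(N : ℤ)) ht).const_mul (e t)
  have iC : Integrable fun x ↦ conj (e t) * (chi a 0 x * conj (chi a (-(N : ℤ)) (x + t))) :=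
    (integrable_chi_mul_conj_chi_shift (a := a) 0 (-(N : ℤ)) ht).const_mul (conj (e t))
  have iAD : Integrable fun x ↦ chi a 0 (x + t) * conj (chi a (-(N : ℤ)) (x + t)) + chi a 0 x * conj (chi a (-(N : ℤ)) x) :=
    iA.add iD
  have iADB : Integrable fun x ↦ chi a 0 (x + t) * conj (chi a (-(N : ℤ)) (x + t)) + chi a 0 x * conj (chi a (-(N : ℤ)) x) -
      e t * (chi a 0 (x + t) * conj (chi a (-(N : ℤ)) x)) := iAD.sub iB
  rw [integral_sub iADB iC, integral_sub iAD iB, integral_add iA iD, integral_const_mul, integral_const_mul,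
    integral_chi_shift_mul_conj_chi_shift ha, integral_chi_mul_conj_chi ha, integral_chi_mul_conj_chi_shift]
  simp only [hne, if_false]
  have hce : cexp (-(I * (((-c) * t : ℝ) : ℂ))) = conj (e t) := by
    rw [show e t = cexp (I * (((-c) * t : ℝ) : ℂ)) from rfl, ← Complex.exp_conj, map_mul, Complex.conj_I,
      Complex.conj_ofReal]
    ring_nf
  rw [hce]
  ring

/-- **The cross increment beyond the window vanishes**: `D_t(u_c, u_{c+Nπ/a}) = 0` for `t ≥ 2a` (`N ≥ 1`). -/
theorem weilIncrementSesq_modulated_pair_of_le (ha : 0 < a) (c : ℝ) {N : ℕ} (hN : 1 ≤ N) {t : ℝ} (ht : 2 * a ≤ t) :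
    weilIncrementSesq (fun x ↦ cexp (I * ((-c) * x : ℝ)) * chi a 0 x)
        (fun x ↦ cexp (I * ((-(c + N * π / a)) * x : ℝ)) * chi a 0 x) t = 0 := by
  rw [weilIncrementSesq_modulated_pair_eq ha c hN (by linarith), integral_chi_shift_mul_conj_chi_of_le ha _ _ ht,
    integral_chi_shift_mul_conj_chi_of_le ha _ _ ht]
  simp

/-- The overlap `∫ χ_0(x + t) conj χ_{−N}(x) dx` inside the window (`0 ≤ t ≤ 2a`, `N ≥ 1`), normalised:
`(−1)^N (e^{−i(Nπ/a)t} − 1)/(2πN i)`. -/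
theorem integral_chi_zero_shift_mul_conj_chi_neg (ha : 0 < a) {N : ℕ} (hN : 1 ≤ N) {t : ℝ} (ht0 : 0 ≤ t)
    (ht : t ≤ 2 * a) :
    ∫ x, chi a 0 (x + t) * conj (chi a (-(N : ℤ)) x) =
      (-1) ^ N * (cexp (-(((N * π / a * t : ℝ)) : ℂ) * I) - 1) / (((2 * π * N : ℝ) : ℂ) * I) := by
  have hne : (0 : ℤ) ≠ -(N : ℤ) := by omega
  rw [integral_chi_shift_mul_conj_chi_of_ne ha hne ht0 ht, add_zero, zpow_neg, zpow_natCast, ← inv_pow, inv_neg_one]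
  push_cast
  simp only [mul_zero, zero_div, zero_mul, Complex.exp_zero, sub_neg_eq_add, zero_add]
  ring_nf

/-- The conjugated reverse overlap `conj ∫ χ_{−N}(x + t) conj χ_0(x) dx` inside the window (`0 ≤ t ≤ 2a`, `N ≥ 1`):
`(−1)^N (1 − e^{i(Nπ/a)t})/(2πN i)`. -/
theorem conj_integral_chi_neg_shift_mul_conj_chi_zero (ha : 0 < a) {N : ℕ} (hN : 1 ≤ N) {t : ℝ} (ht0 : 0 ≤ t)
    (ht : t ≤ 2 * a) :
    conj (∫ x, chi a (-(N : ℤ)) (x + t) * conj (chi a 0 x)) =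
      (-1) ^ N * (1 - cexp ((((N * π / a * t : ℝ)) : ℂ) * I)) / (((2 * π * N : ℝ) : ℂ) * I) := by
  have hne : -(N : ℤ) ≠ 0 := by omega
  rw [integral_chi_shift_mul_conj_chi_of_ne ha hne ht0 ht, zero_add, zpow_neg, zpow_natCast, ← inv_pow, inv_neg_one]
  simp only [map_div₀, map_mul, map_sub, map_pow, map_neg, map_one, Complex.conj_I, Complex.conj_ofReal,
    ← Complex.exp_conj]
  push_cast
  simp only [mul_zero, zero_div, zero_mul, Complex.exp_zero, sub_zero]
  ring_nf

/-- **THE CROSS INCREMENT IN CLOSED FORM** (`0 ≤ t ≤ 2a`, `N ≥ 1`, any centre `c`):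
`D_t(u_c, u_{c+Nπ/a}) = (−1)^N · (sin((c + Nπ/a)t) − sin(ct)) / (Nπ)` — a REAL quantity; this is the function that is
paired with the prime/pole/archimedean atoms in the cross term of the general-centre Beurling–Selberg window law. -/
theorem weilIncrementSesq_modulated_pair (ha : 0 < a) (c : ℝ) {N : ℕ} (hN : 1 ≤ N) {t : ℝ} (ht0 : 0 ≤ t)
    (ht : t ≤ 2 * a) :
    weilIncrementSesq (fun x ↦ cexp (I * ((-c) * x : ℝ)) * chi a 0 x)
        (fun x ↦ cexp (I * ((-(c + N * π / a)) * x : ℝ)) * chi a 0 x) t =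
      ((((-1 : ℝ) ^ N / (N * π)) * (Real.sin ((c + N * π / a) * t) - Real.sin (c * t)) : ℝ) : ℂ) := by
  rw [weilIncrementSesq_modulated_pair_eq ha c hN ht0, integral_chi_zero_shift_mul_conj_chi_neg ha hN ht0 ht,
    conj_integral_chi_neg_shift_mul_conj_chi_zero ha hN ht0 ht]
  have hEm : cexp (I * (((-c) * t : ℝ) : ℂ)) = cexp (-((c * t : ℝ) : ℂ) * I) := by
    congr 1; push_cast; ring
  have hEp : cexp (-(I * (((-c) * t : ℝ) : ℂ))) = cexp (((c * t : ℝ) : ℂ) * I) := by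
    congr 1; push_cast; ring
  rw [hEm, hEp]
  -- `e^{iz} − e^{−iz} = 2i sin z`
  have hsin : ∀ z : ℂ, cexp (z * I) - cexp (-z * I) = 2 * I * Complex.sin z := fun z ↦ by
    linear_combination (-I) * Complex.two_sin z + (cexp (z * I) - cexp (-z * I)) * Complex.I_mul_I
  have r1 := hsin ((c * t : ℝ) : ℂ)
  have hG : cexp (((c * t : ℝ) : ℂ) * I) * cexp ((((N * π / a * t) : ℝ) : ℂ) * I) =
      cexp (((((c + N * π / a) * t) : ℝ) : ℂ) * I) := by
    rw [← Complex.exp_add]; congr 1; push_cast; ring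
  have hG' : cexp (-((c * t : ℝ) : ℂ) * I) * cexp (-(((N * π / a * t) : ℝ) : ℂ) * I) =
      cexp (-((((c + N * π / a) * t) : ℝ) : ℂ) * I) := by
    rw [← Complex.exp_add]; congr 1; push_cast; ring
  have r2 := hsin ((((c + N * π / a) * t) : ℝ) : ℂ)
  rw [← hG, ← hG'] at r2
  have hI : (I : ℂ) ≠ 0 := Complex.I_ne_zero
  have hπ : ((π : ℝ) : ℂ) ≠ 0 := by exact_mod_cast Real.pi_ne_zero
  have hN0 : ((N : ℝ) : ℂ) ≠ 0 := by exact_mod_cast (show (N : ℕ) ≠ 0 by omega)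
  refine Eq.trans (b := -(-1 : ℂ) ^ N *
      ((cexp (((c * t : ℝ) : ℂ) * I) - cexp (-((c * t : ℝ) : ℂ) * I)) -
        (cexp (((c * t : ℝ) : ℂ) * I) * cexp ((((N * π / a * t) : ℝ) : ℂ) * I) -
          cexp (-((c * t : ℝ) : ℂ) * I) * cexp (-(((N * π / a * t) : ℝ) : ℂ) * I))) /
      (((2 * π * N : ℝ) : ℂ) * I)) (by ring) ?_
  rw [r1, r2]
  push_cast
  field_simp
  ring

end Summit.Ventures.WeilGRH

end
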